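import Literature.Analysis.FluidPDE.KNSSTypeIIZoomIn
import Literature.Analysis.FluidPDE.LeiZhang2011WindowLipschitz
import Literature.Analysis.FluidPDE.LeiZhang2011StreamRescaling
import HarnessLib

/-!
# Lei–Zhang 2011, Theorem 1.4: the zoom-in (scale invariance of `r v^θ` and of the stream
# class, the uniform Lipschitz bound up to the final time, locally uniform convergence)

Analysis/FluidPDE **proofs file** (theorems only: no definitions, no named facts, no `sorry`) on
the discharge path of the named fact
`Literature.Analysis.FluidPDE.LeiZhang2011_regularity_bmoStream` (Z. Lei, Q. S. Zhang,
J. Funct. Anal. 261 (2011) = arXiv:1011.5066, **Theorem 1.4**; proof §4, (1.6) and Case 1,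
p. 12). The zoom-in of the printed proof ("`v^{(k)}(x, t) = Q_k⁻¹ v(x_k + x/Q_k, t_k + t/Q_k²)`
… It is clear that `{v^{(k)}}` are mild solutions … converges to a bounded ancient weak solution
… both the stream function and `r v^θ` are scaling invariant") is run in the tree on the frame
of KNSS 2009, Theorem 6.1 (`KNSSTypeIIZoomIn`: near-maximum selection `exists_near_max`, the
rescaled classical solutions `c • stPull (c²) c t₀ (x₀₃ e₃) u` with `zoom_isClassicalNSSolutionOn`,
`zoom_norm_le_two`, `zoom_isAxisymmetric`, the offset `a₀` of norm-`1` value). This file supplies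
what changes when the scale-invariant hypothesis (6.4) `|x'| |u| ≤ C` of KNSS is replaced by the
two scale-invariant hypotheses of Lei–Zhang:

* `swirl_smul_comp_eZ_smul`, `zoom_abs_swirl_le` — **`r v^θ` is scaling invariant**: the bound
  `|swirl| ≤ C` passes to the rescaled velocity;
* `zoom_hasBMOStreamFunctionOn` (with `HasBMOStreamFunctionOn.mono`, `.comp_add_right`) —
  **the stream class is scaling invariant** (`HasBMOStreamFunctionOn.rescale`,
  `LeiZhang2011StreamRescaling`): the rescaled velocity has the rescaled stream function with
  the same `BMO` bound on the rescaled time interval;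
* `lipschitz_up_to_final_time_of_bmoStream` — the uniform Lipschitz bound on `[A + 1, 0] × ℝ³`
  for the rescaled solutions, from the window bound of `LeiZhang2011WindowLipschitz`
  (verbatim the argument of `lipschitz_up_to_final_time`, the stream hypothesis threaded through
  the translated unit windows);
* `tendstoUniformlyOn_of_lipschitz_of_tendsto_of_isCompact`,
  `tendstoLocallyUniformly_of_lipschitz_of_tendsto` — pointwise convergence of an equi-Lipschitz
  sequence is locally uniform (the mode of convergence consumed by the endgame
  `eq_zero_of_tendstoUniformlyOn_of_bmoStream` and by the receding-axes lemma
  `eq_of_tendstoLocallyUniformly_of_rot_about`).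

## Mathlib / tree search

Reused: `stPull`, `smul_stPull_apply`, `zoom_time_mem`, `IsClassicalNSSolutionOn.comp_add_right`,
`.mono`, `.isBoundedWeakNSSolutionOn`, `.smooth_velocity` (`KNSSTypeIIZoomIn`,
`ClassicalBoundedWeak`), `HasBMOStreamFunctionOn.rescale` (`LeiZhang2011StreamRescaling`),
`KNSS2009_regularity_boundedWeak_window.lipschitz_of_bmoStream` (`LeiZhang2011WindowLipschitz`);
Mathlib `finite_cover_balls_of_compact`, `tendstoLocallyUniformly_iff_forall_isCompact`.
The `ℂ`-valued special case of the `δ`-net lemma is the tree's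
`tendstoUniformlyOn_of_lipschitz_of_tendsto` (`IsingLimitLawLaplace`).

## References

* Z. Lei, Q. S. Zhang, J. Funct. Anal. 261 (2011) = arXiv:1011.5066: Thm. 1.4, proof §4, (1.6)
  and Case 1 (p. 12). [LeiZhang2011]
* G. Koch, N. Nadirashvili, G. Seregin, V. Šverák, Acta Math. 203 (2009) = arXiv:0709.3599,
  §6 (6.2)–(6.3), Lemma 6.1, proof of Thm. 6.1 (pp. 11–12). [KochNadirashviliSereginSverak2009]
-/

noncomputable section

open MeasureTheory Set Function Filter Topology TopologicalSpace Metric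
open scoped InnerProductSpace RealInnerProductSpace NNReal ENNReal

namespace Literature.Analysis.FluidPDE

open Literature.Analysis.FunctionSpaces

/-! ### The stream class under time translations and restriction -/

/-- Restricting the time set. [folklore] -/
theorem HasBMOStreamFunctionOn.mono {S S' : Set ℝ}
    {u B : ℝ → EuclideanSpace ℝ (Fin 3) → EuclideanSpace ℝ (Fin 3)} {C : ℝ≥0}
    (h : HasBMOStreamFunctionOn S u B C) (hS : S' ⊆ S) : HasBMOStreamFunctionOn S' u B C :=
  fun t ht => h t (hS ht)

/-- Translating in time. [folklore] -/
theorem HasBMOStreamFunctionOn.comp_add_right {S : Set ℝ}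
    {u B : ℝ → EuclideanSpace ℝ (Fin 3) → EuclideanSpace ℝ (Fin 3)} {C : ℝ≥0}
    (h : HasBMOStreamFunctionOn S u B C) (a : ℝ) :
    HasBMOStreamFunctionOn ((· + a) ⁻¹' S) (fun τ => u (τ + a)) (fun τ => B (τ + a)) C :=
  fun t ht => h (t + a) ht

/-! ### Scale invariance of `Γ = r v^θ` -/

/-- **`r v^θ` is scaling invariant** (Lei–Zhang 2011, proof of Thm. 1.4: "both the stream function
and `r v^θ` are scaling invariant", arXiv:1011.5066 p. 12): for the rescaling centred on the axis,
`swirl (a w(b e_z + c ·)) (y) = (a/c) swirl w (b e_z + c y)` (so `= swirl w (…)` for `a = c`).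
[cite: LeiZhang2011, Thm. 1.4, proof §4, Case 1 (arXiv p. 12)] -/
theorem swirl_smul_comp_eZ_smul (w : EuclideanSpace ℝ (Fin 3) → EuclideanSpace ℝ (Fin 3))
    (a b : ℝ) {c : ℝ} (hc : c ≠ 0) (y : EuclideanSpace ℝ (Fin 3)) :
    swirl (fun y => a • w (b • eZ + c • y)) y = a / c * swirl w (b • eZ + c • y) := by
  simp only [swirl, PiLp.smul_apply, PiLp.add_apply, smul_eq_mul, eZ]
  simp
  field_simp

/-- The rescaled velocity of the zoom centred on the axis has the same bound on `|r v^θ|` as the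
original one (at `a = c`). [cite: LeiZhang2011, Thm. 1.4, proof §4, Case 1 (arXiv p. 12)] -/
theorem zoom_abs_swirl_le {T : ℝ} {u : ℝ → EuclideanSpace ℝ (Fin 3) → EuclideanSpace ℝ (Fin 3)}
    {t₀ c : ℝ} {x₀ : EuclideanSpace ℝ (Fin 3)} {C : ℝ}
    (hC : ∀ t ∈ Ioo 0 T, ∀ x, |swirl (u t) x| ≤ C) (hc : c ≠ 0) {s : ℝ}
    (hs : t₀ + c ^ 2 * s ∈ Ioo 0 T) (y : EuclideanSpace ℝ (Fin 3)) :
    |swirl ((c • stPull (c ^ 2) c t₀ (x₀ 2 • eZ) u) s) y| ≤ C := by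
  have h : (c • stPull (c ^ 2) c t₀ (x₀ 2 • eZ) u) s =
      fun y => c • u (t₀ + c ^ 2 * s) (x₀ 2 • eZ + c • y) := by
    funext y; rfl
  rw [h, swirl_smul_comp_eZ_smul (u (t₀ + c ^ 2 * s)) c (x₀ 2) hc, div_self hc, one_mul]
  exact hC _ hs _

/-! ### Scale invariance of the stream class -/

/-- **The stream class along the zoom centred on the axis**: if `u` has a stream function with
`BMO` slices bounded by `K` on `(0, T)`, the rescaled velocity `c u(t₀ + c² s, x₀₃ e₃ + c y)`
has
the stream function `B(t₀ + c² s, x₀₃ e₃ + c y)` with the same bound on the rescaled interval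
(`HasBMOStreamFunctionOn.rescale`).
[cite: LeiZhang2011, Thm. 1.4, proof §4, Case 1 (arXiv p. 12)] -/
theorem zoom_hasBMOStreamFunctionOn {T : ℝ}
    {u B : ℝ → EuclideanSpace ℝ (Fin 3) → EuclideanSpace ℝ (Fin 3)} {K : ℝ≥0}
    (hB : HasBMOStreamFunctionOn (Ioo 0 T) u B K) {c : ℝ} (hc : c ≠ 0) (t₀ : ℝ)
    (x₀ : EuclideanSpace ℝ (Fin 3)) :
    HasBMOStreamFunctionOn (Ioo (-(t₀ / c ^ 2)) ((T - t₀) / c ^ 2))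
      (c • stPull (c ^ 2) c t₀ (x₀ 2 • eZ) u) (stPull (c ^ 2) c t₀ (x₀ 2 • eZ) B) K := by
  have h := hB.rescale t₀ (x₀ 2 • eZ) hc
  refine (fun s hs => h s (zoom_time_mem hc hs))

/-! ### Uniform Lipschitz bound up to the final time (stream version) -/

/-- **From unit windows to `[A + 1, 0]`, up to the final time — stream version** of
`lipschitz_up_to_final_time`: the window input is the conclusion of
`KNSS2009_regularity_boundedWeak_window.lipschitz_of_bmoStream` (at `M = 2`), and the solution
`(V, P)` on `(A, B)`, `A ≤ −2 < 0 < B`, bounded by `2` on `(A, 0]`, is assumed to have a stream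
function with `BMO` slices on `(A, B)`. Then `‖V(t, x) − V(s, y)‖ ≤ max K 8 (|t − s| + ‖x − y‖)`
on `[A + 1, 0]`. Proof verbatim as in `KNSSTypeIIZoomIn` (translated unit windows, continuity at
the final time, the bound `2` for far-apart times).
[cite: LeiZhang2011, Thm. 1.4, proof §4 (arXiv p. 12)] -/
theorem lipschitz_up_to_final_time_of_bmoStream {K : ℝ}
    (hKprop : ∀ ⦃w : ℝ → (EuclideanSpace ℝ (Fin 3)) → (EuclideanSpace ℝ (Fin 3))⦄,
      IsBoundedWeakNSSolutionOn (Ioo 0 1) isOpen_Ioo 1 w →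
      ContinuousOn (uncurry w) (Ioo (0 : ℝ) 1 ×ˢ univ) →
      (∀ t ∈ Ioo (0 : ℝ) 1, ∀ x, ‖w t x‖ ≤ 2) →
      (∃ (Bw : ℝ → EuclideanSpace ℝ (Fin 3) → EuclideanSpace ℝ (Fin 3)) (Kb : ℝ≥0),
        HasBMOStreamFunctionOn (Ioo 0 1) w Bw Kb) →
      ∀ s ∈ Ico (1 / 2 : ℝ) 1, ∀ t ∈ Ico (1 / 2 : ℝ) 1, ∀ x y : (EuclideanSpace ℝ (Fin 3)),
        ‖w t x - w s y‖ ≤ K * (|t - s| + ‖x - y‖))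
    {A B : ℝ} (hA : A ≤ -2) (hB : 0 < B)
    {V : ℝ → (EuclideanSpace ℝ (Fin 3)) → (EuclideanSpace ℝ (Fin 3))}
    {P : ℝ → (EuclideanSpace ℝ (Fin 3)) → ℝ}
    (hV : IsClassicalNSSolutionOn (Ioo A B) 1 0 V P) (hbd : ∀ s ∈ Ioc A 0, ∀ y, ‖V s y‖ ≤ 2)
    (hstream : ∃ (BV : ℝ → EuclideanSpace ℝ (Fin 3) → EuclideanSpace ℝ (Fin 3)) (Kb : ℝ≥0),
      HasBMOStreamFunctionOn (Ioo A B) V BV Kb) :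
    ∀ s ∈ Icc (A + 1) 0, ∀ t ∈ Icc (A + 1) 0, ∀ x y : (EuclideanSpace ℝ (Fin 3)),
      ‖V t x - V s y‖ ≤ max K 8 * (|t - s| + ‖x - y‖) := by
  obtain ⟨BV, Kb, hBV⟩ := hstream
  -- (i) the window bound, translated: times in `[σ - 1/2, σ)`, `σ ∈ [A + 1, 0]`
  have hwin : ∀ σ ∈ Icc (A + 1) 0, ∀ r₁ ∈ Ico (σ - 1 / 2) σ, ∀ r₂ ∈ Ico (σ - 1 / 2) σ,
      ∀ x y : (EuclideanSpace ℝ (Fin 3)), ‖V r₂ x - V r₁ y‖ ≤ K * (|r₂ - r₁| + ‖x - y‖) := by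
    intro σ hσ r₁ hr₁ r₂ hr₂ x y
    set w : ℝ → (EuclideanSpace ℝ (Fin 3)) → (EuclideanSpace ℝ (Fin 3)) :=
      fun τ => V (τ + (σ - 1)) with hw_def
    have hmem : ∀ τ ∈ Ioo (0 : ℝ) 1, τ + (σ - 1) ∈ Ioo A B := fun τ hτ =>
      ⟨by linarith [hτ.1, hσ.1], by linarith [hτ.2, hσ.2]⟩
    have hw : IsClassicalNSSolutionOn (Ioo 0 1) 1
        (fun τ => (0 : ℝ → (EuclideanSpace ℝ (Fin 3)) → (EuclideanSpace ℝ (Fin 3))) (τ + (σ - 1))) w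
        (fun τ => P (τ + (σ - 1))) :=
      (hV.comp_add_right (σ - 1)).mono (fun τ hτ => hmem τ hτ) (uniqueDiffOn_Ioo 0 1)
    have h0 : (fun τ : ℝ =>
        (0 : ℝ → (EuclideanSpace ℝ (Fin 3)) → (EuclideanSpace ℝ (Fin 3))) (τ + (σ - 1))) = 0 := by
      funext τ; rfl
    have hw' : IsClassicalNSSolutionOn (Ioo 0 1) 1 0 w (fun τ => P (τ + (σ - 1))) := by
      rw [h0] at hw; exact hw
    have hwbd : ∀ τ ∈ Ioo (0 : ℝ) 1, ∀ z, ‖w τ z‖ ≤ 2 := fun τ hτ z =>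
      hbd _ ⟨(hmem τ hτ).1, by linarith [hτ.2, hσ.2]⟩ z
    have hweak := hw'.isBoundedWeakNSSolutionOn ⟨2, hwbd⟩
    have hwc : ContinuousOn (uncurry w) (Ioo (0 : ℝ) 1 ×ˢ univ) :=
      hw'.smooth_velocity.continuousOn
    have hwstream : ∃ (Bw : ℝ → EuclideanSpace ℝ (Fin 3) → EuclideanSpace ℝ (Fin 3)) (Kb : ℝ≥0),
        HasBMOStreamFunctionOn (Ioo 0 1) w Bw Kb :=
      ⟨fun τ => BV (τ + (σ - 1)), Kb, (hBV.comp_add_right (σ - 1)).mono fun τ hτ => hmem τ hτ⟩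
    have key := hKprop hweak hwc hwbd hwstream (r₁ - (σ - 1))
      ⟨by linarith [hr₁.1], by linarith [hr₁.2]⟩
      (r₂ - (σ - 1)) ⟨by linarith [hr₂.1], by linarith [hr₂.2]⟩ x y
    simp only [hw_def, sub_add_cancel] at key
    rwa [show r₂ - (σ - 1) - (r₁ - (σ - 1)) = r₂ - r₁ by ring] at key
  -- (ii) pairs of times `< 0` at distance `< 1/2`
  have hneg : ∀ s ∈ Ico (A + 1) 0, ∀ t ∈ Ico (A + 1) 0, |t - s| < 1 / 2 →
      ∀ x y : (EuclideanSpace ℝ (Fin 3)), ‖V t x - V s y‖ ≤ K * (|t - s| + ‖x - y‖) := by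
    intro s hs t ht hts x y
    have hts' := abs_lt.1 hts
    set σ : ℝ := min 0 (min s t + 1 / 2) with hσ
    have hσA : σ ∈ Icc (A + 1) 0 := by
      refine ⟨le_min (by linarith) ?_, min_le_left _ _⟩
      have := min_le_min hs.1 ht.1
      rw [min_self] at this
      linarith
    refine hwin σ hσA s ⟨?_, ?_⟩ t ⟨?_, ?_⟩ x y
    · have h1 : σ ≤ min s t + 1 / 2 := min_le_right _ _
      have h2 : min s t ≤ s := min_le_left _ _
      linarith
    · refine lt_min hs.2 ?_
      rcases le_total s t with h | h
      · rw [min_eq_left h]; linarith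
      · rw [min_eq_right h]; linarith
    · have h1 : σ ≤ min s t + 1 / 2 := min_le_right _ _
      have h2 : min s t ≤ t := min_le_right _ _
      linarith
    · refine lt_min ht.2 ?_
      rcases le_total s t with h | h
      · rw [min_eq_left h]; linarith
      · rw [min_eq_right h]; linarith
  -- (iii) up to the final time, by continuity of `V`
  have hcontV : ContinuousOn (uncurry V) (Ioo A B ×ˢ univ) := hV.smooth_velocity.continuousOn
  have hopen : IsOpen (Ioo A B ×ˢ (univ : Set (EuclideanSpace ℝ (Fin 3)))) :=
    isOpen_Ioo.prod isOpen_univ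
  have htend : ∀ r ∈ Icc (A + 1) 0, ∀ z : (EuclideanSpace ℝ (Fin 3)),
      Tendsto (fun n : ℕ => V (min r (-(1 / ((n : ℝ) + 1)))) z) atTop (𝓝 (V r z)) := by
    intro r hr z
    have hseq : Tendsto (fun n : ℕ => min r (-(1 / ((n : ℝ) + 1)))) atTop (𝓝 r) := by
      have h0 : Tendsto (fun n : ℕ => -(1 / ((n : ℝ) + 1))) atTop (𝓝 0) := by
        simpa using (tendsto_one_div_add_atTop_nhds_zero_nat (𝕜 := ℝ)).neg
      have := (tendsto_const_nhds (x := r)).min h0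
      rwa [min_eq_left hr.2] at this
    have hcat : ContinuousAt (uncurry V) (r, z) :=
      hcontV.continuousAt (hopen.mem_nhds ⟨⟨by linarith [hr.1], hr.2.trans_lt hB⟩, mem_univ z⟩)
    exact hcat.tendsto.comp (hseq.prodMk_nhds tendsto_const_nhds)
  have hclose : ∀ s ∈ Icc (A + 1) 0, ∀ t ∈ Icc (A + 1) 0, |t - s| < 1 / 2 →
      ∀ x y : (EuclideanSpace ℝ (Fin 3)), ‖V t x - V s y‖ ≤ K * (|t - s| + ‖x - y‖) := by
    intro s hs t ht hts x y
    set sq : ℕ → ℝ := fun n => min s (-(1 / ((n : ℝ) + 1))) with hsq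
    set tq : ℕ → ℝ := fun n => min t (-(1 / ((n : ℝ) + 1))) with htq
    have hneg1 : ∀ n : ℕ, -(1 / ((n : ℝ) + 1)) < 0 := fun n =>
      neg_neg_of_pos (by positivity)
    have hge1 : ∀ n : ℕ, -1 ≤ -(1 / ((n : ℝ) + 1)) := fun n => by
      rw [neg_le_neg_iff, div_le_one (by positivity)]
      linarith [n.cast_nonneg (α := ℝ)]
    have hmemq : ∀ r ∈ Icc (A + 1) 0, ∀ n : ℕ, min r (-(1 / ((n : ℝ) + 1))) ∈ Ico (A + 1) 0 :=
      fun r hr n => ⟨le_min hr.1 (by linarith [hge1 n]), (min_le_right _ _).trans_lt (hneg1 n)⟩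
    have hdist : ∀ n, |tq n - sq n| ≤ |t - s| := fun n => by
      have := abs_min_sub_min_le_max t (-(1 / ((n : ℝ) + 1))) s (-(1 / ((n : ℝ) + 1)))
      rwa [sub_self, abs_zero, max_eq_left (abs_nonneg _)] at this
    have hn : ∀ n, ‖V (tq n) x - V (sq n) y‖ ≤ K * (|tq n - sq n| + ‖x - y‖) := fun n =>
      hneg (sq n) (hmemq s hs n) (tq n) (hmemq t ht n) ((hdist n).trans_lt hts) x y
    have hlhs : Tendsto (fun n => ‖V (tq n) x - V (sq n) y‖) atTop (𝓝 ‖V t x - V s y‖) :=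
      ((htend t ht x).sub (htend s hs y)).norm
    have h0 : Tendsto (fun n : ℕ => -(1 / ((n : ℝ) + 1))) atTop (𝓝 0) := by
      simpa using (tendsto_one_div_add_atTop_nhds_zero_nat (𝕜 := ℝ)).neg
    have hrhs : Tendsto (fun n => K * (|tq n - sq n| + ‖x - y‖)) atTop
        (𝓝 (K * (|t - s| + ‖x - y‖))) := by
      have h1 : Tendsto tq atTop (𝓝 t) := by
        have := (tendsto_const_nhds (x := t)).min h0
        rwa [min_eq_left ht.2] at this
      have h2 : Tendsto sq atTop (𝓝 s) := by
        have := (tendsto_const_nhds (x := s)).min h0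
        rwa [min_eq_left hs.2] at this
      exact (((continuous_abs.tendsto _).comp (h1.sub h2)).add tendsto_const_nhds).const_mul K
    exact le_of_tendsto_of_tendsto' hlhs hrhs hn
  -- (iv) far-apart times by the bound `2`
  intro s hs t ht x y
  have hKle : K ≤ max K 8 := le_max_left _ _
  have hsum0 : 0 ≤ |t - s| + ‖x - y‖ := by positivity
  by_cases hts : |t - s| < 1 / 2
  · exact (hclose s hs t ht hts x y).trans (mul_le_mul_of_nonneg_right hKle hsum0)
  · have h1 : ‖V t x‖ ≤ 2 := hbd t ⟨by linarith [ht.1], ht.2⟩ x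
    have h2 : ‖V s y‖ ≤ 2 := hbd s ⟨by linarith [hs.1], hs.2⟩ y
    have h3 : 1 / 2 ≤ |t - s| := not_lt.1 hts
    calc ‖V t x - V s y‖ ≤ ‖V t x‖ + ‖V s y‖ := norm_sub_le _ _
      _ ≤ 8 * (|t - s| + ‖x - y‖) := by nlinarith [norm_nonneg (x - y)]
      _ ≤ max K 8 * (|t - s| + ‖x - y‖) := mul_le_mul_of_nonneg_right (le_max_right _ _) hsum0

/-! ### From pointwise to locally uniform convergence for equi-Lipschitz sequences -/

/-- On a compact set, an equi-Lipschitz sequence that converges pointwise converges uniformly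
(a `δ`-net argument; the pseudo-metric generalisation of the tree's
`tendstoUniformlyOn_of_lipschitz_of_tendsto`). [folklore] -/
theorem tendstoUniformlyOn_of_lipschitz_of_tendsto_of_isCompact {X Y : Type*}
    [PseudoMetricSpace X] [PseudoMetricSpace Y] {F : ℕ → X → Y} {f : X → Y} {K : Set X}
    (hK : IsCompact K) {L : ℝ} (hL : 0 < L)
    (hF : ∀ k, ∀ z ∈ K, ∀ z' ∈ K, dist (F k z) (F k z') ≤ L * dist z z')
    (h : ∀ z ∈ K, Tendsto (fun k => F k z) atTop (𝓝 (f z))) : TendstoUniformlyOn F f atTop K := by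
  have hf : ∀ z ∈ K, ∀ z' ∈ K, dist (f z) (f z') ≤ L * dist z z' := fun z hz z' hz' =>
    le_of_tendsto ((h z hz).dist (h z' hz')) (Eventually.of_forall fun k => hF k z hz z' hz')
  refine Metric.tendstoUniformlyOn_iff.2 fun ε hε => ?_
  set δ : ℝ := ε / 3 / L with hδ
  have hδpos : 0 < δ := by positivity
  obtain ⟨t, htK, htfin, hcover⟩ := finite_cover_balls_of_compact hK hδpos
  have hev : ∀ᶠ k in atTop, ∀ x ∈ t, dist (F k x) (f x) < ε / 3 :=
    (eventually_all_finite htfin).2 fun x hx =>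
      Metric.tendsto_nhds.1 (h x (htK hx)) _ (by positivity)
  filter_upwards [hev] with k hk z hz
  obtain ⟨x, hxt, hzx⟩ := Set.mem_iUnion₂.1 (hcover hz)
  have hxK := htK hxt
  have hzx' : dist z x < δ := mem_ball.1 hzx
  have hLδ : L * δ = ε / 3 := by rw [hδ]; field_simp
  calc dist (f z) (F k z) ≤ dist (f z) (f x) + dist (f x) (F k x) + dist (F k x) (F k z) :=
        dist_triangle4 _ _ _ _
    _ < ε / 3 + ε / 3 + ε / 3 := by
        gcongr
        · calc dist (f z) (f x) ≤ L * dist z x := hf z hz x hxK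
            _ < L * δ := by gcongr
            _ = ε / 3 := hLδ
        · rw [dist_comm]; exact hk x hxt
        · calc dist (F k x) (F k z) ≤ L * dist x z := hF k x hxK z hz
            _ < L * δ := by rw [dist_comm]; gcongr
            _ = ε / 3 := hLδ
    _ = ε := by ring

/-- **The slices of the rescaled sequence converge locally uniformly**: a sequence of fields on
`ℝ³`, uniformly `L`-Lipschitz, converging pointwise, converges uniformly on every compact set
(hence locally uniformly). This is the mode of convergence "in `L^∞(Ω)` for any compact subset
`Ω`" of the printed proof (Lei–Zhang, arXiv:1011.5066 p. 13). [folklore] -/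
theorem tendstoLocallyUniformly_of_lipschitz_of_tendsto
    {F : ℕ → EuclideanSpace ℝ (Fin 3) → EuclideanSpace ℝ (Fin 3)}
    {f : EuclideanSpace ℝ (Fin 3) → EuclideanSpace ℝ (Fin 3)} {L : ℝ} (hL : 0 < L)
    (hF : ∀ k x y, ‖F k x - F k y‖ ≤ L * ‖x - y‖)
    (h : ∀ x, Tendsto (fun k => F k x) atTop (𝓝 (f x))) :
    TendstoLocallyUniformly F f atTop ∧
      ∀ r : ℝ, TendstoUniformlyOn F f atTop (closedBall (0 : EuclideanSpace ℝ (Fin 3)) r) := by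
  have hK : ∀ K : Set (EuclideanSpace ℝ (Fin 3)), IsCompact K → TendstoUniformlyOn F f atTop K :=
    fun K hKc => tendstoUniformlyOn_of_lipschitz_of_tendsto_of_isCompact hKc hL
      (fun k z _ z' _ => by rw [dist_eq_norm, dist_eq_norm]; exact hF k z z')
      fun z _ => h z
  exact ⟨(tendstoLocallyUniformly_iff_forall_isCompact).2 hK,
    fun r => hK _ (isCompact_closedBall 0 r)⟩

end Literature.Analysis.FluidPDE
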